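import Summits.MatrixMultiplication.MatrixMultiplication.Theorems.ObstructionDescentHullCalculus
import Summits.MatrixMultiplication.MatrixMultiplication.Theorems.ObstructionDescentCornerEquations

/- `set_option linter.dupNamespace false` as in the sibling kernel files (namespace `…Theorems.<FileStem>`). -/
set_option linter.dupNamespace false

/-!
# The poly-degree hull calculus, part 2: what descends to the leaf `E` (decomp-mm · lens 3 · gen 22)

Route `route-MatrixMultiplication-ObstructionDescent` (`ω(ℂ) = 2`); attacked leaf `E = NoPolyDegreeObstruction` (item 30889); aside
`PolyDegreeHullLaws` (this gen).  With the hulls `Hull_D(σ_m)` and the truncated border rank `truncRank` of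
`ObstructionDescentHullCalculus` (restriction-closed, ⊕- and ⊠-hereditary at FIXED degree):

* `noPolyDegreeObstruction_iff_hull`, `noPolyDegreeObstruction_iff_truncRank` — `E ⟺` at the cells `n² ≤ m`, `n^τ ≤ m` the
  corner tensor `⟨n,n,n⟩` lies in `Hull_{m^c}(σ_m)`, i.e. `truncRank (m^c) ⟨n,n,n⟩ ≤ m`: `E` says the degree-truncated border
  ranks of matrix multiplication are quadratic under every polynomial degree budget.
* CONSEQUENCES GIVEN `E` (same cells, SAME absolute degree `m^c`): every restriction `(A⊗B⊗C)·⟨n,n,n⟩` into any format —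
  rectangular products, triangle tensors of tripartite graphs, every bilinear map computed by one `n × n` product — lies in
  `Hull_{m^c}(σ_m)` (`restriction_mem_hull_of_E`); the Kronecker square lies in `Hull_{m^c}(σ_{m²})` (`kroneckerSquare_mem_hull_of_E`)
  and so does `⟨n²,n²,n²⟩` in its own corner format (`matMulTensor_sq_mem_hull_of_E`, via Bläser's double-index relabelling) —
  blindness ASCENDS the Kronecker tower with HALVED degree exponent, `m^c = (m²)^{c/2}`; all powers `⟨n,n,n⟩^{⊠N}` lie in
  `Hull_{m^c}(σ_{m^N})` (`matMulTensor_kroneckerPow_mem_hull_of_E`); mixed cells (`kronecker_directSum_mem_hull_of_E`).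
  Contrapositively, a poly-degree separation found ANYWHERE in the restriction/⊕/⊠-cone of matrix multiplication, `m ≥ n^{2+ε}`
  infinitely often, DESCENDS to a violation of `E`: the search space for `¬E` is that whole cone.
* `polyDegreeHullLaws_holds` closes the aside (the heredity laws, verbatim).

Nothing here proves `ω = 2` or decides `E`; sorry-free; standard axioms only.
[cite: Blaser2013, Lemma 5.4 + Lemma 5.8 + p. 24; BurgisserClausenShokrollahi1997, Prop. (15.25) (pdf p. 423); LandsbergGCT2017, §8.3.2 (p. 226)]
-/

set_option autoImplicit false

noncomputable section

open scoped BigOperators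

namespace Summit.MatrixMultiplication.MatrixMultiplication.Theorems.ObstructionDescentHullDescent

open Literature.Computability.AlgebraicComplexity (tensorRank actTensor kroneckerTensor kroneckerTensor_apply directSumTensor
  kroneckerPow matMulTensor kroneckerTensor_matMulTensor doubleIndexEquiv)
open Summit.MatrixMultiplication.MatrixMultiplication.Theorems.ObstructionDescentTorusLaws (RV mem_RV)
open Summit.MatrixMultiplication.MatrixMultiplication.Theorems.ObstructionDescentHullCalculus
open Summit.MatrixMultiplication.MatrixMultiplication.Theorems.ObstructionDescentCornerEquations (noPolyDegreeObstruction_iff_corner)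
open Summit.MatrixMultiplication.MatrixMultiplication.Theses.ObstructionDescent (NoPolyDegreeObstruction PolyDegreeHullLaws)

/-! ## §1 The leaf `E` in hull language, and what descends to it -/

section Leaf

/-- `E ⟺` at the cells, `⟨n,n,n⟩` lies in the degree-`m^c` hull of `σ_m` of the corner format `(ℂ^{n×n})^{⊗3}`.
[route E = NoPolyDegreeObstruction, corner form] -/
theorem noPolyDegreeObstruction_iff_hull : NoPolyDegreeObstruction ↔
    ∀ c : ℕ, ∀ τ : ℝ, 2 < τ → ∃ n₀ : ℕ, ∀ n m : ℕ, n₀ ≤ n → n * n ≤ m → (n : ℝ) ^ τ ≤ (m : ℝ) →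
      (fun a b c => matMulTensor ℂ n n n a b c) ∈ hull (Fin n × Fin n) (Fin n × Fin n) (Fin n × Fin n) m (m ^ c) :=
  noPolyDegreeObstruction_iff_corner

/-- `E ⟺` the truncated border ranks `R_{m^c}(⟨n,n,n⟩)` are `≤ m` at the cells: quadratic truncated border rank of matrix
multiplication under every polynomial degree budget. [route E, dictionary] -/
theorem noPolyDegreeObstruction_iff_truncRank : NoPolyDegreeObstruction ↔
    ∀ c : ℕ, ∀ τ : ℝ, 2 < τ → ∃ n₀ : ℕ, ∀ n m : ℕ, n₀ ≤ n → n * n ≤ m → (n : ℝ) ^ τ ≤ (m : ℝ) →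
      truncRank (m ^ c) (fun a b c => matMulTensor ℂ n n n a b c) ≤ m := by
  rw [noPolyDegreeObstruction_iff_hull]
  refine forall_congr' fun c => forall_congr' fun τ => forall_congr' fun _ => exists_congr fun n₀ =>
    forall_congr' fun n => forall_congr' fun m => forall_congr' fun _ => forall_congr' fun _ => forall_congr' fun _ => ?_
  exact mem_hull_iff_truncRank_le

/-- **Every restriction of matrix multiplication is blind, given `E`.** At the cells of `E(c, τ)`, for arbitrary matrices
`A, B, C` from the corner format to any format, `(A⊗B⊗C)·⟨n,n,n⟩ ∈ Hull_{m^c}(σ_m)`: rectangular products `⟨n₁,n₂,n₃⟩`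
(`nᵢ ≤ n`), triangle tensors of tripartite graphs on `n+n+n` vertices, every bilinear map computed by one `n × n` product.
Contrapositive: a poly-degree equation of `σ_m` separating ANY such restriction, `m ≥ n^{2+ε}` infinitely often, refutes `E`.
[cite: Blaser2013, Lemma 5.4] -/
theorem restriction_mem_hull_of_E (hE : NoPolyDegreeObstruction) (c : ℕ) (τ : ℝ) (hτ : 2 < τ) :
    ∃ n₀ : ℕ, ∀ n m : ℕ, n₀ ≤ n → n * n ≤ m → (n : ℝ) ^ τ ≤ (m : ℝ) →
      ∀ (α' β' γ' : Type) [Fintype α'] [Fintype β'] [Fintype γ']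
        (A : Matrix α' (Fin n × Fin n) ℂ) (B : Matrix β' (Fin n × Fin n) ℂ) (C : Matrix γ' (Fin n × Fin n) ℂ),
        actTensor A B C (fun a b c => matMulTensor ℂ n n n a b c) ∈ hull α' β' γ' m (m ^ c) := by
  obtain ⟨n₀, h⟩ := noPolyDegreeObstruction_iff_hull.1 hE c τ hτ
  exact ⟨n₀, fun n m hn hcell hτm α' β' γ' _ _ _ A B C => hull_actTensor (h n m hn hcell hτm) A B C⟩

/-- **The Kronecker square is blind one exponent-halving up, given `E`.** At the cells of `E(c, τ)` the Kronecker square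
`⟨n,n,n⟩ ⊠ ⟨n,n,n⟩` (≅ `⟨n²,n²,n²⟩`) lies in `Hull_{m^c}(σ_{m²})` — degree budget `m^c = (m²)^{c/2}`.  Contrapositive (violation
descent): an equation of `σ_{m²}` of degree `≤ (m²)^{c/2}` non-zero at `⟨n,n,n⟩^{⊠2}` yields one of `σ_m` of degree `≤ m^c`
non-zero at `⟨n,n,n⟩`. [cite: Blaser2013, Lemma 5.8] -/
theorem kroneckerSquare_mem_hull_of_E (hE : NoPolyDegreeObstruction) (c : ℕ) (τ : ℝ) (hτ : 2 < τ) :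
    ∃ n₀ : ℕ, ∀ n m : ℕ, n₀ ≤ n → n * n ≤ m → (n : ℝ) ^ τ ≤ (m : ℝ) →
      kroneckerTensor (fun a b c => matMulTensor ℂ n n n a b c) (fun a b c => matMulTensor ℂ n n n a b c) ∈
        hull ((Fin n × Fin n) × (Fin n × Fin n)) ((Fin n × Fin n) × (Fin n × Fin n)) ((Fin n × Fin n) × (Fin n × Fin n))
          (m * m) (m ^ c) := by
  obtain ⟨n₀, h⟩ := noPolyDegreeObstruction_iff_hull.1 hE c τ hτ
  exact ⟨n₀, fun n m hn hcell hτm => hull_kronecker (h n m hn hcell hτm) (h n m hn hcell hτm)⟩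

/-- **`⟨n², n², n²⟩` is blind at `(m², m^c)`, given `E` at `(m, m^c)`** — the Kronecker square transported to its own corner
format along Bläser's double-index relabelling `⟨n,n,n⟩ ⊠ ⟨n,n,n⟩ ≅ ⟨n²,n²,n²⟩`.  Since `(n², m²)` is again a cell of slope `τ`
and `m^c = (m²)^{c/2}`, blindness ASCENDS the Kronecker tower with halved degree exponent; equivalently violations of `E` with
exponent `c/2` at `(n², m²)` DESCEND to violations with exponent `c` at `(n, m)`. [cite: Blaser2013, Lemma 5.8 and p. 24] -/
theorem matMulTensor_sq_mem_hull_of_E (hE : NoPolyDegreeObstruction) (c : ℕ) (τ : ℝ) (hτ : 2 < τ) :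
    ∃ n₀ : ℕ, ∀ n m : ℕ, n₀ ≤ n → n * n ≤ m → (n : ℝ) ^ τ ≤ (m : ℝ) →
      (fun a b c => matMulTensor ℂ (n * n) (n * n) (n * n) a b c) ∈
        hull (Fin (n * n) × Fin (n * n)) (Fin (n * n) × Fin (n * n)) (Fin (n * n) × Fin (n * n)) (m * m) (m ^ c) := by
  obtain ⟨n₀, h⟩ := noPolyDegreeObstruction_iff_hull.1 hE c τ hτ
  refine ⟨n₀, fun n m hn hcell hτm => ?_⟩
  have key : (fun a b c => matMulTensor ℂ (n * n) (n * n) (n * n) a b c) = fun a b c =>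
      kroneckerTensor (fun a b c => matMulTensor ℂ n n n a b c) (fun a b c => matMulTensor ℂ n n n a b c)
        ((doubleIndexEquiv n n n n).symm a) ((doubleIndexEquiv n n n n).symm b) ((doubleIndexEquiv n n n n).symm c) := by
    funext a b c
    rw [show (kroneckerTensor (fun a b c => matMulTensor ℂ n n n a b c) (fun a b c => matMulTensor ℂ n n n a b c)) =
        kroneckerTensor (matMulTensor ℂ n n n) (matMulTensor ℂ n n n) from rfl, kroneckerTensor_matMulTensor,
      Equiv.apply_symm_apply, Equiv.apply_symm_apply, Equiv.apply_symm_apply]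
  rw [key]
  exact hull_precomp (hull_kronecker (h n m hn hcell hτm) (h n m hn hcell hτm)) _ _ _

/-- **All Kronecker powers of `⟨n,n,n⟩` are blind at the same degree, given `E`**: `⟨n,n,n⟩^{⊠N} ∈ Hull_{m^c}(σ_{m^N})`.
[cite: Blaser2013, Lemma 5.8] -/
theorem matMulTensor_kroneckerPow_mem_hull_of_E (hE : NoPolyDegreeObstruction) (c : ℕ) (τ : ℝ) (hτ : 2 < τ) :
    ∃ n₀ : ℕ, ∀ n m : ℕ, n₀ ≤ n → n * n ≤ m → (n : ℝ) ^ τ ≤ (m : ℝ) → ∀ N : ℕ,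
      kroneckerPow (fun a b c => matMulTensor ℂ n n n a b c) N ∈
        hull (Fin N → Fin n × Fin n) (Fin N → Fin n × Fin n) (Fin N → Fin n × Fin n) (m ^ N) (m ^ c) := by
  obtain ⟨n₀, h⟩ := noPolyDegreeObstruction_iff_hull.1 hE c τ hτ
  exact ⟨n₀, fun n m hn hcell hτm N => hull_kroneckerPow (h n m hn hcell hτm) N⟩

/-- **Mixed cells.** Given `E`, `⟨n,n,n⟩ ⊠ ⟨n',n',n'⟩ ∈ Hull_{min(m^c, m'^c)}(σ_{m·m'})` whenever `(n,m)` and `(n',m')` are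
cells of `E(c,τ)`; with `⊕` in place of `⊠`, `∈ Hull(σ_{m+m'})`. [cite: Blaser2013, Lemma 5.8; BurgisserClausenShokrollahi1997, Prop. (15.25)] -/
theorem kronecker_directSum_mem_hull_of_E (hE : NoPolyDegreeObstruction) (c : ℕ) (τ : ℝ) (hτ : 2 < τ) :
    ∃ n₀ : ℕ, ∀ n m n' m' : ℕ, n₀ ≤ n → n * n ≤ m → (n : ℝ) ^ τ ≤ (m : ℝ) → n₀ ≤ n' → n' * n' ≤ m' →
      (n' : ℝ) ^ τ ≤ (m' : ℝ) →
      kroneckerTensor (fun a b c => matMulTensor ℂ n n n a b c) (fun a b c => matMulTensor ℂ n' n' n' a b c) ∈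
          hull ((Fin n × Fin n) × (Fin n' × Fin n')) ((Fin n × Fin n) × (Fin n' × Fin n'))
            ((Fin n × Fin n) × (Fin n' × Fin n')) (m * m') (min (m ^ c) (m' ^ c)) ∧
        directSumTensor (fun a b c => matMulTensor ℂ n n n a b c) (fun a b c => matMulTensor ℂ n' n' n' a b c) ∈
          hull ((Fin n × Fin n) ⊕ (Fin n' × Fin n')) ((Fin n × Fin n) ⊕ (Fin n' × Fin n'))
            ((Fin n × Fin n) ⊕ (Fin n' × Fin n')) (m + m') (min (m ^ c) (m' ^ c)) := by
  obtain ⟨n₀, h⟩ := noPolyDegreeObstruction_iff_hull.1 hE c τ hτ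
  refine ⟨n₀, fun n m n' m' hn hcell hτm hn' hcell' hτm' => ?_⟩
  have h₁ := hull_antitone (min_le_left (m ^ c) (m' ^ c)) (h n m hn hcell hτm)
  have h₂ := hull_antitone (min_le_right (m ^ c) (m' ^ c)) (h n' m' hn' hcell' hτm')
  exact ⟨hull_kronecker h₁ h₂, hull_directSum h₁ h₂⟩

end Leaf

/-! ## §2 The aside `PolyDegreeHullLaws` -/

/-- **The aside `PolyDegreeHullLaws` holds**: restriction-, ⊕- and ⊠-heredity of the degree-`D` hulls, verbatim.
[cite: Blaser2013, Lemma 5.4 + Lemma 5.8; BurgisserClausenShokrollahi1997, Prop. (15.25) (pdf p. 423)] -/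
theorem polyDegreeHullLaws_holds : PolyDegreeHullLaws := by
  refine ⟨?_, ?_⟩
  · intro α β γ α' β' γ' _ _ _ _ _ _ m D s hs A B C g hdeg hg
    have hs' : s ∈ hull α β γ m D := fun f hfd hf => hs f hfd (mem_RV.1 hf)
    exact hull_actTensor hs' A B C g hdeg (mem_RV.2 hg)
  · intro α β γ α' β' γ' _ _ _ _ _ _ m m' D s t hs ht
    have hs' : s ∈ hull α β γ m D := fun f hfd hf => hs f hfd (mem_RV.1 hf)
    have ht' : t ∈ hull α' β' γ' m' D := fun g hgd hg => ht g hgd (mem_RV.1 hg)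
    exact ⟨fun F hdeg hF => hull_directSum hs' ht' F hdeg (mem_RV.2 hF),
      fun F hdeg hF => hull_kronecker hs' ht' F hdeg (mem_RV.2 hF)⟩

end Summit.MatrixMultiplication.MatrixMultiplication.Theorems.ObstructionDescentHullDescent

end
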